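import Literature.AnabelianGeometry.AbsoluteAnabelian.AbsTopIII.BiAnabelianCoresProofs
import Literature.AnabelianGeometry.AbsoluteAnabelian.DiagramUniversalFamilies

/-!
# [AbsTopIII] Cor. 3.7 — `𝒟*` over `𝔈`: the universal family `K₀` and the reference column

[cite: MochizukiAbsTopIII2015, Cor 3.7 (i) p.87] [cite: MochizukiAbsTopIII2015, Cor 3.7 (ii) p.88]
[cite: MochizukiAbsTopIII2015, Cor 3.7 (iii) p.88]

abc-iut-L4-t5 (gen 5), row «COR37-COMPAT-LITERAL» (abc-iut-L4-lead GO 2026-08-26). Groundwork for the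
compatibility clauses of Cor. 3.7 typed in `BiAnabelianCompatibility.lean`, over abc-iut-L4-t9's
`BiAnabelianSetting` / `starDiagram` / `starAug` / `starAugIso` consumed BY NAME (nothing restated):

* `overE` — t9's augmentation of `𝒟*` towards `𝔈` packaged as `OverData` ("every functor of `𝒟*` lies over
  `𝔈`"); `coresFamily` — the universal family `K₀` of homotopies on `𝒟*` over `𝔈` through the core vertex
  `𝔈` (Def. 3.5 (ii); abc-iut-L4-t2's `univFamily`), the family that realises the core structures of (i), (ii).
* **The reference column.** `IsRefCol` = the vertices `𝒳 ×_𝔈 𝒳` (row 1) and the core vertex `𝒳`;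
  `refFun` = the canonical functor to `𝒳` (`π_⋎` on row 1, the identity at `𝒳`), `refIso : refFun ⋙ gal ≅ starAug`
  (the structure 2-cell `α⁻¹` of the fibre square on row 1, the identity at `𝒳`).
* `pathFunctor_comp_refFun` — EVERY path of `𝒟*` into the reference column, followed by the canonical functor,
  IS the canonical functor of its source ("the second factor `𝒳` is a universal reference model": `log_𝒳 ×_𝔈 𝒳`
  does not touch the second factor, `δ_𝒳 ⋙ π = 𝟭`).
* `overE_pathIso_hom_app` — **the augmentation isomorphism over `𝔈` along EVERY such path is the canonical
  one** (`refIso⁻¹ ≫ refIso`, objectwise `α⁻¹`): the 2-cells `logGal` picked up along `log_𝒳` telescope against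
  the base change `(A₁, A₂, α) ↦ (log A₁, A₂, logGal_{A₁} ≫ α)`, and `δ(A) = (A, A, id)` ("the Galois group is
  undisturbed"). Consequences `pathFunctor_eq_of_target_ref` / `overE_pathIso_hom_app_eq_of_target_ref`: two
  co-verticial paths into `𝒳` have THE SAME functor and THE SAME augmentation isomorphism — i.e. the identity
  homotopies of the `𝒳`-core of (i) (t9's `refCoreFamily`) and the homotopies of `K₀` AGREE wherever both are
  defined, which is the cross condition needed to realise the `𝒳`-core and the `𝔈`-cores in ONE family
  (Cor. 3.7 (iii), second clause; sequel).

Honest framing: 2-categorical bookkeeping about t9's abstract setting; model-level, not node-level; nothing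
here bears on [IUTchIII] Cor. 3.12. typed ≠ proved elsewhere; here every statement is proved.
-/

set_option autoImplicit false

namespace Literature.AnabelianGeometry.AbsoluteAnabelian.AbsTopIII

open CategoryTheory Quiver
open Literature.AnabelianGeometry.AbsoluteAnabelian.DiagramOfCategories

universe u

namespace BiAnabelianSetting

variable {X E N : Type u} [Category.{u} X] [Category.{u} E] [Category.{u} N]
  (𝔖 : BiAnabelianSetting X E N)

/-! ## `𝒟*` over `𝔈` and the universal family `K₀` -/

/-- **Every functor of `𝒟*` lies over `𝔈`** — abc-iut-L4-t9's augmentation `starAug`/`starAugIso` packaged as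
structure functors over `𝔈` (`OverData`): the identity at `𝔈`, `gal`, `pr ⋙ gal`, `𝒩 → 𝔈`.
[cite: MochizukiAbsTopIII2015, Cor 3.7 (i) p.87] -/
def overE : 𝔖.starDiagram.OverData E where
  N := 𝔖.starAug
  μ e := 𝔖.starAugIso e

/-- The core vertex `𝔈` of `𝒟*`. [cite: MochizukiAbsTopIII2015, Cor 3.7 (i) p.87] -/
def galoisVertex : Cor37Vertex → Prop := fun v => v = .galois

/-- At `𝔈` the structure functor over `𝔈` is the identity, fully faithful. [cite: MochizukiAbsTopIII2015, Cor 3.7 (i) p.87] -/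
def galoisVertex_fullyFaithful : ∀ w : Cor37Vertex, galoisVertex w → (𝔖.overE.N w).FullyFaithful
  | .galois, _ => Functor.FullyFaithful.id E
  | .first _, h => False.elim (by cases h)
  | .box, h => False.elim (by cases h)
  | .space, h => False.elim (by cases h)
  | .ref, h => False.elim (by cases h)

/-- **`K₀`: the universal family of homotopies on `𝒟*` over `𝔈` through the core vertex `𝔈`** (pairs
`([σ]∘[γ₁], [σ]∘[γ₂])` with `γ₁, γ₂` co-verticial into `𝔈`; homotopies the canonical identifications over `𝔈`).
[cite: MochizukiAbsTopIII2015, Cor 3.7 (ii) p.88] -/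
noncomputable def coresFamily : 𝔖.starDiagram.HomotopyFamily :=
  univFamily 𝔖.overE galoisVertex 𝔖.galoisVertex_fullyFaithful

/-! ## The reference column `{𝒳 ×_𝔈 𝒳 (row 1), 𝒳}` -/

/-- The reference column of `Γ⃗_{𝒟*}`: the row-1 vertices `𝒳 ×_𝔈 𝒳` and the core vertex `𝒳` (the vertices
that map canonically to the "universal reference model" `𝒳`). [cite: MochizukiAbsTopIII2015, Cor 3.7 (i) p.87] -/
def IsRefCol : Cor37Vertex → Prop
  | .first _ => True
  | .ref => True
  | .box => False
  | .space => False
  | .galois => False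

/-- The reference column is closed backwards along edges (no edge enters it from `□`, `𝒩`, `𝔈`).
[cite: MochizukiAbsTopIII2015, Cor 3.7 (ii) p.87] -/
theorem isRefCol_src {a b : Cor37Vertex} (e : a ⟶ b) (hb : IsRefCol b) : IsRefCol a := by
  cases e <;> trivial

/-- Hence closed backwards along paths. [cite: MochizukiAbsTopIII2015, Cor 3.7 (ii) p.87] -/
theorem isRefCol_of_path {a b : Cor37Vertex} (p : Path a b) (hb : IsRefCol b) : IsRefCol a := by
  induction p with
  | nil => exact hb
  | cons p e ih => exact ih (isRefCol_src e hb)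

/-- The canonical functor to the reference model `𝒳`: `π_⋎` (second projection) on row 1, the identity at `𝒳`.
[cite: MochizukiAbsTopIII2015, Cor 3.7 (i) p.87] -/
def refFun : ∀ a : Cor37Vertex, IsRefCol a → (𝔖.starDiagram.obj a ⥤ X)
  | .first _, _ => 𝔖.proj
  | .ref, _ => 𝟭 X
  | .box, h => h.elim
  | .space, h => h.elim
  | .galois, h => h.elim

/-- The canonical 2-cell `refFun ⋙ gal ≅ starAug`: on row 1 the inverse structure 2-cell `π ⋙ gal ≅ pr ⋙ gal` of
the fibre square (objectwise `α⁻¹` at `(A₁, A₂, α)`), the identity at `𝒳`. [cite: MochizukiAbsTopIII2015, Cor 3.7 (i) p.87] -/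
def refIso : ∀ (a : Cor37Vertex) (ha : IsRefCol a), 𝔖.refFun a ha ⋙ 𝔖.gal ≅ 𝔖.starAug a
  | .first _, _ => (FiberSquare.prCompIsoSndComp 𝔖.gal).symm
  | .ref, _ => 𝔖.gal.leftUnitor
  | .box, h => h.elim
  | .space, h => h.elim
  | .galois, h => h.elim

/-- **"`𝒳` is a universal reference model"**: every path of `𝒟*` into the reference column followed by the
canonical functor to `𝒳` IS the canonical functor of its source (`log_𝒳 ×_𝔈 𝒳 ⋙ π = π`, `π`, `δ ⋙ π = 𝟭`, all on
the nose). [cite: MochizukiAbsTopIII2015, Cor 3.7 (i) p.87] -/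
theorem pathFunctor_comp_refFun {a b : Cor37Vertex} (p : Path a b) (hb : IsRefCol b) (ha : IsRefCol a) :
    𝔖.starDiagram.pathFunctor p ⋙ 𝔖.refFun b hb = 𝔖.refFun a ha := by
  induction p with
  | nil => rw [pathFunctor_nil]; rfl
  | cons p e ih =>
    rw [pathFunctor_cons, Functor.assoc]
    cases e with
    | log m n h => exact ih trivial
    | pr n => exact hb.elim
    | lamTimes => exact hb.elim
    | lamTimesPf => exact hb.elim
    | toGal => exact hb.elim
    | proj n => exact ih trivial
    | diag n => exact ih trivial
    | diagBox => exact hb.elim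

/-- Two co-verticial paths of `𝒟*` into the core vertex `𝒳` have THE SAME functor.
[cite: MochizukiAbsTopIII2015, Cor 3.7 (i) p.87] -/
theorem pathFunctor_eq_of_target_ref {a : Cor37Vertex} (p q : Path a .ref) :
    𝔖.starDiagram.pathFunctor p = 𝔖.starDiagram.pathFunctor q :=
  ((𝔖.starDiagram.pathFunctor p).comp_id.symm.trans
    (𝔖.pathFunctor_comp_refFun p trivial (isRefCol_of_path p trivial))).trans
    ((𝔖.starDiagram.pathFunctor q).comp_id.symm.trans
      (𝔖.pathFunctor_comp_refFun q trivial (isRefCol_of_path p trivial))).symm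

/-! ### Components of the structure 2-cells (definitional unfoldings) -/

/-- Along `log_𝒳 ×_𝔈 𝒳` the augmentation 2-cell is `logGal` at the first factor. [cite: MochizukiAbsTopIII2015, Cor 3.7 (i) p.87] -/
theorem overE_μ_log_hom_app (m n : ℤ) (h : m = n + 1) (y : 𝔖.Sq) :
    (𝔖.overE.μ (Cor37Edge.log m n h)).hom.app y = 𝔖.logGal.hom.app y.fst := rfl

/-- Along `π_⋎` the augmentation 2-cell is `α⁻¹`. [cite: MochizukiAbsTopIII2015, Cor 3.7 (i) p.87] -/
theorem overE_μ_proj_hom_app (n : ℤ) (y : 𝔖.Sq) :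
    (𝔖.overE.μ (Cor37Edge.proj n)).hom.app y = y.iso.inv := rfl

/-- Along `δ_⋎` the augmentation 2-cell is the identity. [cite: MochizukiAbsTopIII2015, Cor 3.7 (ii) p.87] -/
theorem overE_μ_diag_hom_app (n : ℤ) (y : X) :
    (𝔖.overE.μ (Cor37Edge.diag n)).hom.app y = 𝟙 _ := rfl

/-- On row 1, `refIso⁻¹` is `α` objectwise. [cite: MochizukiAbsTopIII2015, Cor 3.7 (i) p.87] -/
theorem refIso_first_inv_app (n : ℤ) (h : IsRefCol (.first n)) (y : 𝔖.Sq) :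
    (𝔖.refIso (.first n) h).inv.app y = y.iso.hom := rfl

/-- At `𝒳`, `refIso⁻¹` is the identity. [cite: MochizukiAbsTopIII2015, Cor 3.7 (i) p.87] -/
theorem refIso_ref_inv_app (h : IsRefCol .ref) (y : X) :
    (𝔖.refIso .ref h).inv.app y = 𝟙 _ := rfl

/-- At `𝒳`, `refIso` is the identity. [cite: MochizukiAbsTopIII2015, Cor 3.7 (i) p.87] -/
theorem refIso_ref_hom_app (h : IsRefCol .ref) (y : X) :
    (𝔖.refIso .ref h).hom.app y = 𝟙 _ := rfl

/-- The base change `log_𝒳 ×_𝔈 𝒳` replaces `α` by `logGal ≫ α`. [cite: MochizukiAbsTopIII2015, Cor 3.7 p.86] -/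
theorem comp_map_log_obj_iso_hom {C : Type u} [Category.{u} C] (F : C ⥤ 𝔖.Sq) (m n : ℤ) (h : m = n + 1)
    (x : C) :
    ((F ⋙ 𝔖.starDiagram.map (Cor37Edge.log m n h)).obj x).iso.hom =
      𝔖.logGal.hom.app (F.obj x).fst ≫ (F.obj x).iso.hom := rfl

/-- The diagonal carries the identity 2-cell: `δ(A) = (A, A, id)`. [cite: MochizukiAbsTopIII2015, Cor 3.7 (ii) p.87] -/
theorem comp_map_diag_obj_iso_hom {C : Type u} [Category.{u} C] (F : C ⥤ X) (n : ℤ) (x : C) :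
    ((F ⋙ 𝔖.starDiagram.map (Cor37Edge.diag n)).obj x).iso.hom = 𝟙 (𝔖.gal.obj (F.obj x)) := rfl

/-- `ι⁻¹_y ≫ eqToHom ≫ ι_x` across equal objects `y = x` is the `eqToHom`. [folklore] -/
private theorem iso_inv_app_eqToHom_hom_app {C D : Type u} [Category.{u} C] [Category.{u} D] {F G : C ⥤ D}
    (ι : F ≅ G) {y x : C} (h : y = x) :
    ι.inv.app y ≫ eqToHom (by rw [h]) ≫ ι.hom.app x = eqToHom (by rw [h]) := by
  subst h
  simp

/-! ### The augmentation isomorphism along paths into the reference column is canonical -/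

/-- **Main lemma ("the Galois group is undisturbed" along the reference column).** For EVERY path `γ` of `𝒟*`
into the reference column, the structure isomorphism `𝒟*_{[γ]} ⋙ starAug ≅ starAug` of the augmentation over `𝔈`
(t5's `OverData.pathIso`, composed from t9's `starAugIso` along `γ`) is the CANONICAL one
`refIso⁻¹ ≫ eqToHom ≫ refIso` (objectwise: `α` of the end object, which `pathFunctor_comp_refFun` identifies, then
`α⁻¹` of the start object): the `logGal`'s telescope against the base change and `δ` contributes identities.
[cite: MochizukiAbsTopIII2015, Cor 3.7 (i) p.87] -/
theorem overE_pathIso_hom_app {a b : Cor37Vertex} (p : Path a b) (hb : IsRefCol b) (ha : IsRefCol a)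
    (x : 𝔖.starDiagram.obj a) :
    (𝔖.overE.pathIso p).hom.app x =
      (𝔖.refIso b hb).inv.app ((𝔖.starDiagram.pathFunctor p).obj x) ≫
        eqToHom (congrArg 𝔖.gal.obj (Functor.congr_obj (𝔖.pathFunctor_comp_refFun p hb ha) x)) ≫
        (𝔖.refIso a ha).hom.app x := by
  induction p with
  | nil =>
    rw [OverData.pathIso_nil_app]
    exact (iso_inv_app_eqToHom_hom_app (𝔖.refIso a ha)
      (Functor.congr_obj (𝔖.starDiagram.pathFunctor_nil a) x)).symm
  | cons p e ih =>
    rw [OverData.pathIso_cons_app]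
    cases e with
    | pr n => exact hb.elim
    | lamTimes => exact hb.elim
    | lamTimesPf => exact hb.elim
    | toGal => exact hb.elim
    | diagBox => exact hb.elim
    | log m n h =>
      rw [ih trivial, NatTrans.congr (𝔖.refIso (.first n) hb).inv
        (Functor.congr_obj (𝔖.starDiagram.pathFunctor_cons p _) x), eqToHom_map, eqToHom_map]
      rw [overE_μ_log_hom_app, refIso_first_inv_app, refIso_first_inv_app]
      erw [comp_map_log_obj_iso_hom]
      repeat erw [Category.assoc]
      repeat erw [eqToHom_trans_assoc]
      rfl
    | proj n =>
      rw [ih trivial, NatTrans.congr (𝔖.refIso .ref hb).inv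
        (Functor.congr_obj (𝔖.starDiagram.pathFunctor_cons p _) x), eqToHom_map, eqToHom_map]
      rw [overE_μ_proj_hom_app, refIso_first_inv_app, refIso_ref_inv_app]
      erw [Iso.inv_hom_id_assoc]
      repeat erw [Category.assoc]
      repeat erw [Category.id_comp]
      repeat erw [eqToHom_trans_assoc]
      rfl
    | diag n =>
      rw [ih trivial, NatTrans.congr (𝔖.refIso (.first n) hb).inv
        (Functor.congr_obj (𝔖.starDiagram.pathFunctor_cons p _) x), eqToHom_map, eqToHom_map]
      rw [overE_μ_diag_hom_app, refIso_ref_inv_app, refIso_first_inv_app]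
      erw [comp_map_diag_obj_iso_hom]
      repeat erw [Category.assoc]
      repeat erw [Category.id_comp]
      repeat erw [eqToHom_trans_assoc]
      rfl

/-- **Corollary: two co-verticial paths into `𝒳` carry THE SAME augmentation isomorphism** (up to the
`eqToHom` of `pathFunctor_eq_of_target_ref`) — the identity homotopy between them (the `𝒳`-core's, Cor. 3.7 (i))
lies over `𝔈` exactly as the universal family `K₀` prescribes. [cite: MochizukiAbsTopIII2015, Cor 3.7 (iii) p.88] -/
theorem overE_pathIso_hom_app_eq_of_target_ref {a : Cor37Vertex} (p q : Path a .ref)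
    (x : 𝔖.starDiagram.obj a) :
    (𝔖.overE.pathIso p).hom.app x =
      eqToHom (congrArg 𝔖.gal.obj (Functor.congr_obj (𝔖.pathFunctor_eq_of_target_ref p q) x)) ≫
        (𝔖.overE.pathIso q).hom.app x := by
  rw [𝔖.overE_pathIso_hom_app p trivial (isRefCol_of_path p trivial),
    𝔖.overE_pathIso_hom_app q trivial (isRefCol_of_path p trivial), refIso_ref_inv_app, refIso_ref_inv_app]
  repeat erw [Category.id_comp]
  repeat erw [eqToHom_trans_assoc]
  rfl

end BiAnabelianSetting

end Literature.AnabelianGeometry.AbsoluteAnabelian.AbsTopIII
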